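import Summits.ResolutionOfSingularities.ResolutionOfSingularities.Theorems.FrobeniusClosingSteerBetaNewtonTransport
import Literature.AlgebraicGeometry.Resolution.CharPolyhedronMinimalIsMinimum
import HarnessLib

/-!
# Crux `Steer` (stmt-ResolutionOfSingularities-16345), chain W4.1, β-LEAF, K-β2♭ part (II), file 3: the STRICT TRANSFORM is
# pinned by the radicand relation — `φ f = (φ y)^d · f₁` from `φ (u·f) = (φ y)^(2k) · (u₁·f₁)` and the two cone clauses (def-free)

OURS (campaign `res-hironaka`, rung L ★L-G4, slot W4.1; statements about the route's own objects; they replace the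
role of no printed item and are NOT statements of the manuscript under review [claim: Hironaka2017, status:
under-review]; AI review is weaker than expert review). Seat res-D-pv-003 (gen 7), K-β2♭ kernel owner.

res-L0-w41-idea-1's hat letter laws bind the two stages by the RADICAND RELATION `φ (u · f) = (φ y)^(2k) · (u₁ · f₁)`
(RULING 150: `s_i² = y₁^(2k) · s_(i+1)²`) rather than by `φ f = (φ y)^d · f₁`; this file recovers the latter (and the twist
bookkeeping `u₁ = x₁^a · (φ y)^(a + b + d − 2k)`) from the cone clauses `f ≡ Ψ(z, w)`, `f₁ ≡ Ψ₁(z₁, w₁)` with `Ψ, Ψ₁` ROOTLESS: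

* `exists_strictTransform` — `φ(𝔪^d) ⊆ (φ y)^d`, so `φ f = (φ y)^d · g` for some `g`.
* `eval_one_zero_eq_coeff`, `coeff_single_notMem_of_rootless` — a rootless binary form has a UNIT `Z^d`-coefficient.
* `single_two_mem_minExponents_of_cone` — hence `(0, 0, d, 0) ∈ 𝐒(f)` (Cossart–Piltant isolation lemma).
* `not_dvd_of_mem_minExponents` — an element with a minimal exponent `a`, `a_l = 0`, is not divisible by `t_l`.
* `eq_of_prime_pow_mul_eq` — unique factorisation bookkeeping for two non-associated primes.
* **`strictTransform_eq_of_radicand`** — `g = f₁`, `a₁ = a` and `a + b + d = 2k + b₁`.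

[cite: CossartPiltant2019, Prop. 2.1] [cite: CossartJannsenSaito2020, Lemma 12.2] No Theses file is imported; nothing here is a
route item or a registration.
-/

noncomputable section

-- `Summit.<S>.<S>.…` duplicates the summit name by design (single-problem summit).
set_option linter.dupNamespace false

namespace Summit.ResolutionOfSingularities.ResolutionOfSingularities.Theorems.SwitchingDichotomy.BetaNewton

open IsLocalRing
open Literature.AlgebraicGeometry.Resolution
open Literature.AlgebraicGeometry.Resolution.CossartPiltant (uPow uPow_mem_span_uPow uPow_mem_span_uPow_of_le minExponents
  uPow_add uPow_single mem_minExponents_of_isolated)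
open Summit.ResolutionOfSingularities.ResolutionOfSingularities.Theorems.SwitchingDichotomy.BetaPolygon
open Summit.ResolutionOfSingularities.ResolutionOfSingularities.Theorems.SwitchingDichotomy.BetaLetter
  (range_four uPow_four monomial_eq_uPow span_four_pow_eq_span_uPow)

variable {S S₁ : Type} [CommRing S] [CommRing S₁]

/-! ## §1 The strict transform exists -/

/-- Along the `y`-chart substitution, `φ (x, y, z, w)^d ⊆ ((φ y)^d)`: every `f ∈ (x,y,z,w)^d` has `φ f = (φ y)^d · g`.
[cite: CossartJannsenSaito2020, Lemma 12.2] -/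
theorem exists_strictTransform (φ : S →+* S₁) {x y z w : S} {x₁ z₁ w₁ : S₁} (hx : φ x = φ y * x₁)
    (hz : φ z = φ y * z₁) (hw : φ w = φ y * w₁) {d : ℕ} {f : S} (hfd : f ∈ Ideal.span {x, y, z, w} ^ d) :
    ∃ g : S₁, φ f = φ y ^ d * g := by
  have hmap : Ideal.map φ (Ideal.span {x, y, z, w}) ≤ Ideal.span {φ y} := by
    rw [Ideal.map_span, Ideal.span_le]
    rintro _ ⟨t, ht, rfl⟩
    simp only [Set.mem_insert_iff, Set.mem_singleton_iff] at ht
    rcases ht with rfl | rfl | rfl | rfl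
    · exact hx ▸ Ideal.mul_mem_right _ _ (Ideal.mem_span_singleton_self _)
    · exact Ideal.mem_span_singleton_self _
    · exact hz ▸ Ideal.mul_mem_right _ _ (Ideal.mem_span_singleton_self _)
    · exact hw ▸ Ideal.mul_mem_right _ _ (Ideal.mem_span_singleton_self _)
  have h : φ f ∈ Ideal.span {φ y ^ d} := by
    rw [← Ideal.span_singleton_pow]
    refine Ideal.pow_right_mono hmap d ?_
    rw [← Ideal.map_pow]
    exact Ideal.mem_map_of_mem φ hfd
  obtain ⟨g, hg⟩ := Ideal.mem_span_singleton'.mp h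
  exact ⟨g, by rw [← hg, mul_comm]⟩

/-! ## §2 A rootless binary form has a unit `Z^d`-coefficient; hence `(0, 0, d, 0) ∈ 𝐒(f)` -/

/-- For a binary form `P` of degree `d`, `P(1, 0)` is the coefficient of `Z^d`. [folklore] -/
theorem eval_one_zero_eq_coeff {R : Type*} [CommSemiring R] {P : MvPolynomial (Fin 2) R} {d : ℕ}
    (hP : P.IsHomogeneous d) : MvPolynomial.eval ![(1 : R), 0] P = P.coeff (Finsupp.single 0 d) := by
  classical
  conv_lhs => rw [P.as_sum, map_sum]
  simp only [MvPolynomial.eval_monomial, Finsupp.prod_pow, Fin.prod_univ_two, Matrix.cons_val_zero, Matrix.cons_val_one,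
    Matrix.cons_val_fin_one, one_pow, one_mul]
  rw [Finset.sum_eq_single (Finsupp.single 0 d)]
  · simp
  · intro s hs hne
    by_cases hs1 : s 1 = 0
    · exfalso
      apply hne
      have hdeg : s.degree = d := by
        by_contra h
        exact (MvPolynomial.mem_support_iff.mp hs) (hP.coeff_eq_zero h)
      rw [Finsupp.degree_eq_sum, Fin.sum_univ_two, hs1, add_zero] at hdeg
      ext i
      fin_cases i
      · simpa using hdeg
      · simpa using hs1
    · rw [zero_pow hs1, mul_zero]
  · intro h
    rw [MvPolynomial.notMem_support_iff.mp h, zero_mul]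

/-- A binary form that is ROOTLESS over the residue field (in particular `Ψ̄(1, 0) ≠ 0`) has a unit `Z^d`-coefficient.
[folklore] -/
theorem coeff_single_notMem_of_rootless [IsLocalRing S] {Ψ : MvPolynomial (Fin 2) S} {d : ℕ} (hΨ : Ψ.IsHomogeneous d)
    (h : MvPolynomial.eval ![(1 : ResidueField S), 0] (MvPolynomial.map (residue S) Ψ) ≠ 0) :
    Ψ.coeff (Finsupp.single 0 d) ∉ maximalIdeal S := by
  rw [eval_one_zero_eq_coeff (hΨ.map (residue S)), MvPolynomial.coeff_map] at h
  intro hmem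
  exact h ((residue_eq_zero_iff _).mpr hmem)

/-- **`(0, 0, d, 0) ∈ 𝐒(f)` at an arithmetic stage**: if `f ≡ Ψ(z, w) (mod (x, y)·𝔪^(d−1) + 𝔪^(d+1))` for a form `Ψ` of degree
`d` with unit `Z^d`-coefficient, then the exponent of `z^d` is a minimal exponent of `f` (Cossart–Piltant isolation lemma).
[cite: CossartPiltant2019, Prop. 2.1] -/
theorem single_two_mem_minExponents_of_cone [IsLocalRing S] {x y z w : S} (ht : IsRsopPart ![x, y, z, w])
    (hspan : Ideal.span {x, y, z, w} = maximalIdeal S) {d : ℕ} {f : S} {Ψ : MvPolynomial (Fin 2) S}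
    (hΨ : Ψ.IsHomogeneous d) (hΨd : Ψ.coeff (Finsupp.single 0 d) ∉ maximalIdeal S)
    (hf : f - MvPolynomial.eval ![z, w] Ψ ∈
      Ideal.span {x, y} * maximalIdeal S ^ (d - 1) ⊔ maximalIdeal S ^ (d + 1)) :
    (Pi.single 2 d : Fin 4 → ℕ) ∈ minExponents ![x, y, z, w] f := by
  classical
  haveI := ht.isRegularLocalRing
  set t : Fin 4 → S := ![x, y, z, w] with htdef
  set c : Fin 4 → ℕ := Pi.single 2 d with hc
  set B : Set (Fin 4 → ℕ) := {m | d ≤ ∑ l, m l ∧ m ≠ c} with hB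
  -- the exponent of `z^i w^j`
  have hzw : ∀ i j : ℕ, z ^ i * w ^ j = uPow t ![0, 0, i, j] := fun i j => by
    rw [htdef, uPow_four]; simp
  have hc_eq : uPow t c = z ^ d := by
    rw [htdef, uPow_four, hc]; simp
  -- `𝔪^n` is the monomial ideal of total degree `≥ n`
  have hpow : ∀ n : ℕ, maximalIdeal S ^ n = Ideal.span (uPow t '' {m | n ≤ ∑ l, m l}) := fun n => by
    rw [← hspan, htdef, span_four_pow_eq_span_uPow]
  -- (1) `𝔪^(d+1) ≤ (t^b : b ∈ B)`
  have h1 : maximalIdeal S ^ (d + 1) ≤ Ideal.span (uPow t '' B) := by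
    rw [hpow]
    refine Ideal.span_mono (Set.image_mono fun m hm => ⟨by simp only [Set.mem_setOf_eq] at hm; omega, fun hmc => ?_⟩)
    simp only [Set.mem_setOf_eq] at hm
    rw [hmc, hc, sum_four] at hm
    simp at hm
  -- (2) `(x, y) · 𝔪^(d−1) ≤ (t^b : b ∈ B)`
  have h2 : Ideal.span {x, y} * maximalIdeal S ^ (d - 1) ≤ Ideal.span (uPow t '' B) := by
    rw [hpow, Ideal.span_mul_span', Ideal.span_le]
    rintro _ ⟨g, hg, _, ⟨m, hm, rfl⟩, rfl⟩
    simp only [Set.mem_setOf_eq] at hm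
    simp only [Set.mem_insert_iff, Set.mem_singleton_iff] at hg
    have key : ∀ l : Fin 4, l = 0 ∨ l = 1 → t l * uPow t m ∈ Ideal.span (uPow t '' B) := by
      intro l hl
      rw [← uPow_single t l, ← uPow_add]
      refine Ideal.subset_span ⟨_, ⟨?_, fun hmc => ?_⟩, rfl⟩
      · have : ∑ i, ((Pi.single l 1 : Fin 4 → ℕ) + m) i = 1 + ∑ i, m i := by
          simp only [Pi.add_apply, Finset.sum_add_distrib, Finset.sum_pi_single', Finset.mem_univ, if_true]
        simp only [this]
        omega
      · have := congrFun hmc l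
        rcases hl with rfl | rfl <;> simp [hc] at this
    rcases hg with rfl | rfl
    · simpa [htdef] using key 0 (Or.inl rfl)
    · simpa [htdef] using key 1 (Or.inr rfl)
  -- (3) the non-leading terms of `Ψ(z, w)`
  have hΨsum : MvPolynomial.eval ![z, w] Ψ =
      Ψ.coeff (Finsupp.single 0 d) * uPow t c +
        ∑ s ∈ Ψ.support.erase (Finsupp.single 0 d), Ψ.coeff s * uPow t ![0, 0, s 0, s 1] := by
    have hterm : ∀ s : Fin 2 →₀ ℕ, MvPolynomial.eval ![z, w] (MvPolynomial.monomial s (Ψ.coeff s)) =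
        Ψ.coeff s * uPow t ![0, 0, s 0, s 1] := fun s => by
      rw [MvPolynomial.eval_monomial, Finsupp.prod_pow, Fin.prod_univ_two]
      simp [hzw]
    conv_lhs => rw [Ψ.as_sum, map_sum]
    simp only [hterm]
    by_cases hmem : Finsupp.single 0 d ∈ Ψ.support
    · rw [← Finset.add_sum_erase _ _ hmem]
      congr 2
      rw [hc_eq, ← hzw]; simp
    · rw [MvPolynomial.notMem_support_iff.mp hmem, zero_mul, zero_add, Finset.erase_eq_of_notMem hmem]
  have h3 : ∑ s ∈ Ψ.support.erase (Finsupp.single 0 d), Ψ.coeff s * uPow t ![0, 0, s 0, s 1] ∈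
      Ideal.span (uPow t '' B) := by
    refine Ideal.sum_mem _ fun s hs => Ideal.mul_mem_left _ _ (Ideal.subset_span ⟨_, ⟨?_, fun hsc => ?_⟩, rfl⟩)
    · obtain ⟨hne, hs'⟩ := Finset.mem_erase.mp hs
      have hdeg : s.degree = d := by
        by_contra h
        exact (MvPolynomial.mem_support_iff.mp hs') (hΨ.coeff_eq_zero h)
      rw [Finsupp.degree_eq_sum, Fin.sum_univ_two] at hdeg
      simp only [sum_four]
      simp [hdeg]
    · obtain ⟨hne, -⟩ := Finset.mem_erase.mp hs
      apply hne
      have h2c := congrFun hsc 2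
      have h3c := congrFun hsc 3
      simp [hc] at h2c h3c
      ext i; fin_cases i
      · simpa using h2c
      · simpa using h3c
  -- assemble the isolation lemma
  have hfiso : f = Ψ.coeff (Finsupp.single 0 d) * uPow t c +
      (∑ s ∈ Ψ.support.erase (Finsupp.single 0 d), Ψ.coeff s * uPow t ![0, 0, s 0, s 1] +
        (f - MvPolynomial.eval ![z, w] Ψ)) := by
    rw [hΨsum]; ring
  refine mem_minExponents_of_isolated t ht.mem_span_image_of_mul_mem ht.mem_maximalIdeal hfiso
    (add_mem h3 ((sup_le h2 h1) hf)) (fun b hb hbc => hb.2 ?_) ?_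
  · -- `b ≤ c`, `|b| ≥ d` forces `b = c`
    obtain ⟨hbd, -⟩ := hb
    have hb0 := hbc 0; have hb1 := hbc 1; have hb2 := hbc 2; have hb3 := hbc 3
    simp only [hc, Pi.single_eq_same, Pi.single_eq_of_ne (show (0 : Fin 4) ≠ 2 by decide),
      Pi.single_eq_of_ne (show (1 : Fin 4) ≠ 2 by decide), Pi.single_eq_of_ne (show (3 : Fin 4) ≠ 2 by decide),
      Nat.le_zero] at hb0 hb1 hb2 hb3
    rw [sum_four] at hbd
    funext l
    fin_cases l <;> simp [hc, hb0, hb1, hb3]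
    omega
  · rwa [range_four, hspan]

/-! ## §3 Divisibility and unique-factorisation bookkeeping -/

/-- An element with a minimal exponent `a`, `a_l = 0`, is NOT divisible by the parameter `t_l`. [cite: CossartPiltant2019, Prop. 2.1] -/
theorem not_dvd_of_mem_minExponents [IsLocalRing S] {n : ℕ} {t : Fin n → S} (ht : IsRsopPart t) {g : S}
    {a : Fin n → ℕ} (ha : a ∈ minExponents t g) {l : Fin n} (hl : a l = 0) : ¬ t l ∣ g := by
  intro hdvd
  have hg : g ∈ Ideal.span (uPow t '' {Pi.single l 1}) := by
    rw [Set.image_singleton, uPow_single]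
    exact Ideal.mem_span_singleton.mpr hdvd
  obtain ⟨b, hb, hba⟩ := exists_le_of_mem_span_uPow ht hg ha
  rw [Set.mem_singleton_iff] at hb
  subst hb
  have := hba l
  rw [Pi.single_eq_same, hl] at this
  exact Nat.not_succ_le_zero 0 this

/-- **Unique factorisation bookkeeping**: for non-associated primes `p, q` of a domain and `g, h` divisible by neither,
`p^m q^n g = p^m' q^n' h` forces `m = m'`, `n = n'` and `g = h`. [folklore] -/
theorem eq_of_prime_pow_mul_eq [IsDomain S] {p q g h : S} (hp : Prime p) (hq : Prime q) (hpq : ¬ p ∣ q)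
    (hpg : ¬ p ∣ g) (hph : ¬ p ∣ h) (hqg : ¬ q ∣ g) (hqh : ¬ q ∣ h) {m n m' n' : ℕ}
    (H : p ^ m * q ^ n * g = p ^ m' * q ^ n' * h) : m = m' ∧ n = n' ∧ g = h := by
  -- first the `p`-exponents agree
  have key_p : ∀ {m m' n n' : ℕ} {g h : S}, ¬ p ∣ h → p ^ m * q ^ n * g = p ^ m' * q ^ n' * h → ¬ m' < m := by
    intro m m' n n' g h hph H hlt
    obtain ⟨e, rfl⟩ := Nat.exists_eq_add_of_lt hlt
    have : q ^ n' * h = p ^ (e + 1) * (q ^ n * g) := by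
      have h1 : p ^ m' * (q ^ n' * h) = p ^ m' * (p ^ (e + 1) * (q ^ n * g)) := by
        calc p ^ m' * (q ^ n' * h) = p ^ m' * q ^ n' * h := by ring
          _ = p ^ (m' + e + 1) * q ^ n * g := H.symm
          _ = p ^ m' * (p ^ (e + 1) * (q ^ n * g)) := by ring
      exact mul_left_cancel₀ (pow_ne_zero _ hp.ne_zero) h1
    have hdvd : p ∣ q ^ n' * h := ⟨p ^ e * (q ^ n * g), by rw [this]; ring⟩
    rcases hp.dvd_or_dvd hdvd with h1 | h1
    · exact hpq (hp.dvd_of_dvd_pow h1)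
    · exact hph h1
  have hm : m = m' := by
    rcases lt_trichotomy m m' with hlt | heq | hgt
    · exact absurd hlt (key_p hpg H.symm)
    · exact heq
    · exact absurd hgt (key_p hph H)
  subst hm
  have H' : q ^ n * g = q ^ n' * h := by
    have : p ^ m * (q ^ n * g) = p ^ m * (q ^ n' * h) := by
      calc p ^ m * (q ^ n * g) = p ^ m * q ^ n * g := by ring
        _ = p ^ m * q ^ n' * h := H
        _ = p ^ m * (q ^ n' * h) := by ring
    exact mul_left_cancel₀ (pow_ne_zero _ hp.ne_zero) this
  have key_q : ∀ {n n' : ℕ} {g h : S}, ¬ q ∣ h → q ^ n * g = q ^ n' * h → ¬ n' < n := by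
    intro n n' g h hqh H hlt
    obtain ⟨e, rfl⟩ := Nat.exists_eq_add_of_lt hlt
    have : h = q ^ (e + 1) * g := by
      have h1 : q ^ n' * h = q ^ n' * (q ^ (e + 1) * g) := by
        calc q ^ n' * h = q ^ (n' + e + 1) * g := H.symm
          _ = q ^ n' * (q ^ (e + 1) * g) := by ring
      exact mul_left_cancel₀ (pow_ne_zero _ hq.ne_zero) h1
    exact hqh ⟨q ^ e * g, by rw [this]; ring⟩
  have hn : n = n' := by
    rcases lt_trichotomy n n' with hlt | heq | hgt
    · exact absurd hlt (key_q hqg H'.symm)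
    · exact heq
    · exact absurd hgt (key_q hqh H')
  subst hn
  exact ⟨rfl, rfl, mul_left_cancel₀ (pow_ne_zero _ hq.ne_zero) H'⟩

/-! ## §4 The strict transform is pinned by the radicand relation -/

/-- **`φ f = (φ y)^d · f₁` from the RADICAND RELATION.** Along the `y`-chart letter, if `φ f = (φ y)^d · g` with
`(0, 0, ·, 0)`-type minimal exponents of `g` and of `f₁` (the cone clauses: unit `z₁^d`-coefficients, so neither is divisible by
`x₁` or by `φ y`), and `φ (u · f) = (φ y)^(2k) · (u₁ · f₁)` with `u = x^a y^b`, `u₁ = x₁^a₁ (φ y)^b₁`, then `g = f₁`, `a₁ = a` and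
`2k + b₁ = a + b + d`. [cite: CossartJannsenSaito2020, Lemma 12.2] -/
theorem strictTransform_eq_of_radicand [IsLocalRing S₁] (φ : S →+* S₁) {x y u f : S} {x₁ z₁ w₁ u₁ f₁ g : S₁}
    (ht' : IsRsopPart ![x₁, φ y, z₁, w₁]) (hx : φ x = φ y * x₁) {d k a b a₁ b₁ : ℕ}
    (hu : u = x ^ a * y ^ b) (hu₁ : u₁ = x₁ ^ a₁ * φ y ^ b₁) (hg : φ f = φ y ^ d * g)
    (hrad : φ (u * f) = φ y ^ (2 * k) * (u₁ * f₁))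
    {ag : Fin 4 → ℕ} (hag : ag ∈ minExponents ![x₁, φ y, z₁, w₁] g) (hag0 : ag 0 = 0) (hag1 : ag 1 = 0)
    {af : Fin 4 → ℕ} (haf : af ∈ minExponents ![x₁, φ y, z₁, w₁] f₁) (haf0 : af 0 = 0) (haf1 : af 1 = 0) :
    g = f₁ ∧ a₁ = a ∧ 2 * k + b₁ = a + b + d := by
  haveI := ht'.isRegularLocalRing
  haveI : IsDomain S₁ := isDomain_of_isRegularLocalRing S₁
  have hpx : Prime x₁ := by simpa using ht'.prime 0
  have hpy : Prime (φ y) := by simpa using ht'.prime 1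
  have hxy : ¬ x₁ ∣ φ y := by simpa using ht'.not_dvd (i := 0) (j := 1) (by decide)
  have hxg : ¬ x₁ ∣ g := by simpa using not_dvd_of_mem_minExponents ht' hag (l := 0) hag0
  have hyg : ¬ φ y ∣ g := by simpa using not_dvd_of_mem_minExponents ht' hag (l := 1) hag1
  have hxf : ¬ x₁ ∣ f₁ := by simpa using not_dvd_of_mem_minExponents ht' haf (l := 0) haf0
  have hyf : ¬ φ y ∣ f₁ := by simpa using not_dvd_of_mem_minExponents ht' haf (l := 1) haf1
  have H : x₁ ^ a * φ y ^ (a + b + d) * g = x₁ ^ a₁ * φ y ^ (2 * k + b₁) * f₁ := by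
    have h1 : φ (u * f) = x₁ ^ a * φ y ^ (a + b + d) * g := by
      rw [map_mul, hu, map_mul, map_pow, map_pow, hx, hg]; ring
    rw [← h1, hrad, hu₁]; ring
  obtain ⟨h1, h2, h3⟩ := eq_of_prime_pow_mul_eq hpx hpy hxy hxg hxf hyg hyf H
  exact ⟨h3, h1.symm, h2.symm⟩

end Summit.ResolutionOfSingularities.ResolutionOfSingularities.Theorems.SwitchingDichotomy.BetaNewton

end
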